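import Mathlib.Algebra.Polynomial.Homogenize
import Mathlib.Algebra.MvPolynomial.Equiv
import Mathlib.Algebra.MvPolynomial.PDeriv
import Mathlib.RingTheory.MvPolynomial.Ideal
import Mathlib.RingTheory.MvPolynomial.EulerIdentity
import Mathlib.RingTheory.Polynomial.Eisenstein.Basic
import Mathlib.FieldTheory.Separable
import HarnessLib

/-!
# The Picard form `y³ z - z⁴ f(x/z)`: homogeneity, irreducibility, Jacobian criterion

The plane projective model of the **Picard curve** `y³ = f(x)`, `f` a quartic, is the plane quartic
`V₊(F) ⊂ ℙ²` cut out by the **Picard form**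

  `F = x₁³ x₂ - F₄(x₀, x₂)`,  `F₄(x₀, x₂) = x₂⁴ f(x₀/x₂) = Σ_{i ≤ 4} aᵢ x₀ⁱ x₂^{4-i}`

(`picardForm f`, `quarticHom f`; coordinates `(x₀ : x₁ : x₂) = (x : y : z)`, the homogenisation is
Mathlib's `Polynomial.homogenize` placed in the variables `x₀, x₂`). This file is the polynomial
algebra behind the smooth projective model (`Motives/PicardQuarticHypersurface`):

* `isHomogeneous_picardForm` — `F` is a form of degree `4`; `map_picardForm` — base change;
  `quarticHom_eq_sum` — the explicit sum; `coeff_finSuccEquiv_picardForm` — `F` as a polynomial in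
  `x₀` over `K[x₁, x₂]`.
* `irreducible_picardForm` — **`F` is irreducible over every field as soon as `a₄ ≠ 0`**, by
  Eisenstein's criterion at the prime `(x₂)` of `K[x₁, x₂]` applied to
  `-a₄ x₀⁴ - a₃ x₂ x₀³ - a₂ x₂² x₀² - a₁ x₂³ x₀ + x₂ (x₁³ - a₀ x₂³)` (unit leading coefficient,
  `irreducible_of_eisenstein_eval_of_isUnit`, the non-monic variant of the tree's
  `SmoothHypersurface.irreducible_of_eisenstein_eval`); no hypothesis on the characteristic.
* `forall_X_mem_of_prime` — **the projective Jacobian criterion** (Hartshorne I Ex. 5.8): if `3 ≠ 0`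
  in `K` and `f` is a separable quartic, every prime ideal containing `F` and its three partial
  derivatives contains `x₀, x₁, x₂`. Ingredients: `∂₁F = 3x₁²x₂` (`pderiv_one_picardForm`);
  `F₄ ≡ a₄x₀⁴ (mod x₂)` (`quarticHom_sub_mem_span`); `∂₂F₄ ∈ (x₀, x₂)`
  (`pderiv_two_quarticHom_mem_span`, a form of degree `3` in `x₀, x₂`); and the homogenised Bezout
  identity `x₂ᴺ = Â F₄ + B̂ ∂₀F₄` from `A f + B f' = 1` (`exists_X_two_pow_eq`, with
  `∂₀ (p.homogenize n) = p'.homogenize (n - 1)`, `pderiv_zero_homogenize`).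

Everything is proved; no named facts. Mathlib searched: `Polynomial.homogenize` (`homogenize_mul`,
`aeval_homogenize_of_eq_one`, `eval_homogenize`, `isHomogeneous_homogenize`),
`MvPolynomial.finSuccEquiv`, `Polynomial.IsEisensteinAt.irreducible`,
`MvPolynomial.mem_ideal_span_X_image`, `MvPolynomial.IsHomogeneous.pderiv` (all used); Mathlib has no
plane curves, no Picard curves.

## References

* R. Hartshorne, *Algebraic Geometry*, GTM 52 (1977): I Ex. 5.8 (projective Jacobian criterion),
  II Example 3.2.6. [Hartshorne1977]
* R.-P. Holzapfel, *The Ball and Some Hilbert Problems*, Birkhäuser (1995), Ch. I (Picard curves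
  `y³ = p₄(x)` as smooth plane quartics); here only the elementary equation is used. [folklore]
-/

noncomputable section

open MvPolynomial

universe u

namespace Literature.AlgebraicGeometry.Motives.PicardQuartic

variable {k : Type*} [CommRing k]

/-- The embedding of the two variables `(x, z)` of `Polynomial.homogenize` into the three projective
coordinates `(x₀ : x₁ : x₂) = (x : y : z)`: `0 ↦ 0`, `1 ↦ 2` (`Fin.succAbove 1`). [folklore] -/
abbrev xz : Fin 2 → Fin 3 := Fin.succAbove 1

/-- `xz 0 = 0`. [folklore] -/
@[simp] theorem xz_zero : xz 0 = 0 := rfl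

/-- `xz 1 = 2`. [folklore] -/
@[simp] theorem xz_one : xz 1 = 2 := rfl

/-- `xz` is injective. [folklore] -/
theorem xz_injective : Function.Injective xz := Fin.succAbove_right_injective

/-- The homogenised quartic `F₄(x₀, x₂) = x₂⁴ f(x₀/x₂) = Σ_{i ≤ 4} aᵢ x₀ⁱ x₂^{4-i}` of `f = Σ aᵢ Xⁱ`
(Mathlib `Polynomial.homogenize`, placed in the variables `x₀, x₂`; coefficients of `f` above
degree `4` are ignored). [folklore] -/
def quarticHom (f : Polynomial k) : MvPolynomial (Fin 3) k :=
  rename xz (f.homogenize 4)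

/-- **The Picard form** `x₁³ x₂ - F₄(x₀, x₂)`: the homogeneous equation `y³ z = z⁴ f(x/z)` of the
projective closure in `ℙ²` of the affine Picard curve `y³ = f(x)`, `deg f = 4`. [folklore] -/
def picardForm (f : Polynomial k) : MvPolynomial (Fin 3) k :=
  X 1 ^ 3 * X 2 - quarticHom f

/-- `F₄` is a form of degree `4`. [folklore] -/
theorem isHomogeneous_quarticHom (f : Polynomial k) : (quarticHom f).IsHomogeneous 4 :=
  (f.isHomogeneous_homogenize (n := 4)).rename_isHomogeneous

/-- The Picard form is a form of degree `4`. [folklore] -/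
theorem isHomogeneous_picardForm (f : Polynomial k) : (picardForm f).IsHomogeneous 4 := by
  refine IsHomogeneous.sub ?_ (isHomogeneous_quarticHom f)
  simpa using ((isHomogeneous_X k (1 : Fin 3)).pow 3).mul (isHomogeneous_X k (2 : Fin 3))

/-- Base change of `F₄`: `φ(F₄(f)) = F₄(φ f)`. [folklore] -/
theorem map_quarticHom {K : Type*} [CommRing K] (φ : k →+* K) (f : Polynomial k) :
    MvPolynomial.map φ (quarticHom f) = quarticHom (f.map φ) := by
  rw [quarticHom, quarticHom, Polynomial.homogenize_map, map_rename]

/-- Base change of the Picard form: `φ(F(f)) = F(φ f)` (the form is defined over the field of the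
coefficients of `f`). [folklore] -/
theorem map_picardForm {K : Type*} [CommRing K] (φ : k →+* K) (f : Polynomial k) :
    MvPolynomial.map φ (picardForm f) = picardForm (f.map φ) := by
  simp [picardForm, map_quarticHom]

/-- Explicit form: `F₄ = Σ_{i < 5} aᵢ x₀ⁱ x₂^{4-i}`. [folklore] -/
theorem quarticHom_eq_sum (f : Polynomial k) :
    quarticHom f = ∑ i ∈ Finset.range 5, C (f.coeff i) * X 0 ^ i * X 2 ^ (4 - i) := by
  rw [quarticHom, Polynomial.homogenize, map_sum]
  rw [Finset.Nat.sum_antidiagonal_eq_sum_range_succ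
    (fun i j => rename xz (monomial (fun₀ | 0 => i | 1 => j) (f.coeff i))) 4]
  refine Finset.sum_congr rfl fun i _ => ?_
  rw [rename_monomial, MvPolynomial.monomial_eq, Finsupp.prod_mapDomain_index_inj xz_injective,
    Finsupp.prod_fintype _ _ (fun _ => pow_zero _), Fin.prod_univ_two]
  simp [mul_assoc]


/-! ### Irreducibility over every field: Eisenstein at the prime `(z)` -/

section Irreducible

variable {K : Type*} [Field K]

/-- `finSuccEquiv` on constants (also `WeierstrassCurve.Projective.finSuccEquiv_C_eq` of
`EllipticCurves/WeierstrassCubicForm`, not imported here). [folklore] -/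
private theorem finSuccEquiv_C' (n : ℕ) (r : K) :
    finSuccEquiv K n (C r) = Polynomial.C (C r) := by
  rw [finSuccEquiv_apply]
  simp

/-- The coefficients of the Picard form in `x₀`-adic form (`K[x₁, x₂][x₀]`, indices of `K[x₁, x₂]`
renumbered from `0`): the coefficient of `x₀ⁿ` is `δ_{n,0} · x₀³ x₁ - aₙ x₁^{4-n}` (`n ≤ 4`). [folklore] -/
theorem coeff_finSuccEquiv_picardForm (f : Polynomial K) (n : ℕ) :
    (finSuccEquiv K 2 (picardForm f)).coeff n =
      (if n = 0 then X 0 ^ 3 * X 1 else 0) -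
        if n < 5 then C (f.coeff n) * X 1 ^ (4 - n) else 0 := by
  have h1 : finSuccEquiv K 2 (X 1) = Polynomial.C (X 0) := finSuccEquiv_X_succ (j := 0)
  have h2 : finSuccEquiv K 2 (X 2) = Polynomial.C (X 1) := finSuccEquiv_X_succ (j := 1)
  rw [picardForm, quarticHom_eq_sum, map_sub, map_sum, map_mul, map_pow, h1, h2,
    Polynomial.coeff_sub]
  congr 1
  · rw [← map_pow, ← map_mul, Polynomial.coeff_C]
  · simp only [map_mul, map_pow, finSuccEquiv_C', finSuccEquiv_X_zero, h2]
    rw [Polynomial.finsetSum_coeff]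
    simp only [← map_pow, ← Polynomial.C_mul, mul_right_comm _ (Polynomial.X ^ _),
      Polynomial.coeff_C_mul, Polynomial.coeff_X_pow]
    simp [Finset.mem_range]

/-- **Eisenstein's criterion at a rational point, unit leading coefficient.** A polynomial `q` of
positive degree over `R = K[xᵢ]` with unit leading coefficient, all of whose non-leading coefficients
vanish at a point `a`, and whose constant coefficient has a partial derivative not vanishing at `a`,
is irreducible (Eisenstein at `𝓟 = ker (eval a)`). [folklore] -/
theorem irreducible_of_eisenstein_eval_of_isUnit {σ : Type*} (q : Polynomial (MvPolynomial σ K))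
    (hlead : IsUnit q.leadingCoeff) (hdeg : 0 < q.natDegree) (a : σ → K)
    (hcoeff : ∀ i < q.natDegree, MvPolynomial.eval a (q.coeff i) = 0) (l : σ)
    (hder : MvPolynomial.eval a (pderiv l (q.coeff 0)) ≠ 0) : Irreducible q := by
  set 𝓟 : Ideal (MvPolynomial σ K) := RingHom.ker (MvPolynomial.eval a)
  have hP : 𝓟.IsPrime := RingHom.ker_isPrime _
  have hE : q.IsEisensteinAt 𝓟 :=
    { leading := by
        rw [RingHom.mem_ker]
        exact (hlead.map (MvPolynomial.eval a)).ne_zero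
      mem := fun hi => (RingHom.mem_ker).mpr (hcoeff _ hi)
      notMem := fun h0 => hder ?_ }
  · refine hE.irreducible hP ?_ hdeg
    rw [Polynomial.isPrimitive_iff_isUnit_of_C_dvd]
    intro r hr
    rw [Polynomial.C_dvd_iff_dvd_coeff] at hr
    exact isUnit_of_dvd_unit (hr q.natDegree) hlead
  · -- partial derivatives of elements of `𝓟²` vanish at `a`
    rw [pow_two] at h0
    refine Submodule.mul_induction_on h0 (fun p hp r hr => ?_) (fun p r hp hr => ?_)
    · rw [RingHom.mem_ker] at hp hr
      rw [Derivation.leibniz, smul_eq_mul, smul_eq_mul, map_add, map_mul, map_mul, hp, hr]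
      ring
    · rw [map_add, map_add, hp, hr, add_zero]

/-- **The Picard form is irreducible** over every field, for every `f` of degree exactly `4`
(`a₄ ≠ 0`): in `K[y, z][x]` it is `-a₄ x⁴ - a₃ z x³ - a₂ z² x² - a₁ z³ x + (y³ z - a₀ z⁴)`, Eisenstein
at the prime `(z)` — all non-leading coefficients are divisible by `z`, and the constant one,
`z (y³ - a₀ z³)`, is not divisible by `z²` (its `z`-derivative is `1` at `(y, z) = (1, 0)`).
No hypothesis on the characteristic. [folklore] -/
theorem irreducible_picardForm (f : Polynomial K) (hf : f.coeff 4 ≠ 0) :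
    Irreducible (picardForm f) := by
  rw [← MulEquiv.irreducible_iff (finSuccEquiv K 2)]
  set q := finSuccEquiv K 2 (picardForm f) with hq
  have hcoeff := coeff_finSuccEquiv_picardForm f
  have hc4 : q.coeff 4 = -C (f.coeff 4) := by
    rw [hcoeff]; simp
  have hdeg : q.natDegree = 4 := by
    refine le_antisymm ?_ (Polynomial.le_natDegree_of_ne_zero ?_)
    · rw [Polynomial.natDegree_le_iff_coeff_eq_zero]
      intro n hn
      rw [hcoeff, if_neg (by omega), if_neg (by omega), sub_zero]
    · rw [hc4, neg_ne_zero, Ne, C_eq_zero]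
      exact hf
  have hlead : q.leadingCoeff = -C (f.coeff 4) := by rw [Polynomial.leadingCoeff, hdeg, hc4]
  -- the point `(y, z) = (1, 0)`
  let a : Fin 2 → K := fun j => if j = 0 then 1 else 0
  have ha0 : a 0 = 1 := by simp [a]
  have ha1 : a 1 = 0 := by simp [a]
  refine irreducible_of_eisenstein_eval_of_isUnit q ?_ (by omega) a (fun i hi => ?_) 1 ?_
  · rw [hlead, IsUnit.neg_iff]
    exact (isUnit_iff_ne_zero.mpr hf).map C
  · rw [hdeg] at hi
    rw [hcoeff, map_sub]
    split_ifs <;> simp [ha0, ha1, show 4 - i ≠ 0 by omega]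
  · rw [hcoeff, if_pos rfl, if_pos (by omega)]
    simp [ha0, ha1, Derivation.leibniz_pow]

end Irreducible


/-! ### Partial derivatives of the homogenisation -/

/-- **`∂/∂x₀` of a homogenisation is the homogenisation of the derivative**:
`∂₀ (p.homogenize n) = (p').homogenize (n - 1)` for `deg p ≤ n`. [folklore] -/
theorem pderiv_zero_homogenize (p : Polynomial k) {n : ℕ} (hp : p.natDegree ≤ n) :
    pderiv 0 (p.homogenize n) = (Polynomial.derivative p).homogenize (n - 1) := by
  conv_lhs => rw [p.as_sum_range' (n + 1) (by omega)]
  conv_rhs => rw [p.as_sum_range' (n + 1) (by omega)]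
  rw [Polynomial.homogenize_finsetSum, map_sum, Polynomial.derivative_sum,
    Polynomial.homogenize_finsetSum]
  refine Finset.sum_congr rfl fun i hi => ?_
  rw [Finset.mem_range] at hi
  rw [Polynomial.homogenize_monomial (by omega), pderiv_monomial, Polynomial.derivative_monomial]
  rcases Nat.eq_zero_or_pos i with rfl | hi0
  · simp
  · rw [Polynomial.homogenize_monomial (by omega)]
    have hd : ((fun₀ | 0 => i | 1 => n - i) - Finsupp.single (0 : Fin 2) 1 : Fin 2 →₀ ℕ) =
        (fun₀ | 0 => i - 1 | 1 => n - 1 - (i - 1)) := by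
      ext j
      fin_cases j
      · simp
      · simp
        omega
    rw [hd]
    congr 1
    simp

/-- `∂₀ F₄ = F₃'`: the `x₀`-derivative of the homogenised quartic is the homogenised derivative
(placed in the variables `x₀, x₂`). [folklore] -/
theorem pderiv_zero_quarticHom (f : Polynomial k) (hf : f.natDegree ≤ 4) :
    pderiv 0 (quarticHom f) = rename xz ((Polynomial.derivative f).homogenize 3) := by
  rw [quarticHom, ← xz_zero, pderiv_rename xz_injective, pderiv_zero_homogenize f hf]

/-- `∂₁ F₄ = 0` (`F₄` does not involve `x₁ = y`). [folklore] -/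
theorem pderiv_one_quarticHom (f : Polynomial k) : pderiv 1 (quarticHom f) = 0 := by
  rw [quarticHom_eq_sum, map_sum]
  refine Finset.sum_eq_zero fun i _ => ?_
  simp [Derivation.leibniz, Derivation.leibniz_pow, pderiv_X_of_ne (i := (1 : Fin 3)) (j := 0) (by decide),
    pderiv_X_of_ne (i := (1 : Fin 3)) (j := 2) (by decide)]

/-- `F₄ ≡ a₄ x₀⁴ (mod x₂)`. [folklore] -/
theorem quarticHom_sub_mem_span (f : Polynomial k) :
    quarticHom f - C (f.coeff 4) * X 0 ^ 4 ∈ Ideal.span {(X 2 : MvPolynomial (Fin 3) k)} := by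
  have h : quarticHom f - C (f.coeff 4) * X 0 ^ 4 =
      (∑ i ∈ Finset.range 4, C (f.coeff i) * X 0 ^ i * X 2 ^ (3 - i)) * X 2 := by
    rw [quarticHom_eq_sum, Finset.sum_range_succ, Nat.sub_self, pow_zero, mul_one, add_sub_cancel_right,
      Finset.sum_mul]
    refine Finset.sum_congr rfl fun i hi => ?_
    rw [Finset.mem_range] at hi
    rw [show 4 - i = (3 - i) + 1 by omega, pow_succ]
    ring
  rw [h]
  exact Ideal.mul_mem_left _ _ (Ideal.subset_span rfl)

/-- Monomials of `F₄` and of its partial derivatives do not involve `x₁`. [folklore] -/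
theorem apply_one_eq_zero_of_mem_support_rename {p : MvPolynomial (Fin 2) k} {m : Fin 3 →₀ ℕ}
    (hm : m ∈ (rename xz p).support) : m 1 = 0 := by
  rw [support_rename_of_injective xz_injective, Finset.mem_image] at hm
  obtain ⟨d, -, rfl⟩ := hm
  exact Finsupp.mapDomain_notin_range _ _ (by decide)

/-- `∂₂ F₄ ∈ (x₀, x₂)`: it is a form of degree `3` in `x₀, x₂` only, so each of its monomials
involves `x₀` or `x₂`. [folklore] -/
theorem pderiv_two_quarticHom_mem_span (f : Polynomial k) :
    pderiv 2 (quarticHom f) ∈ Ideal.span {(X 0 : MvPolynomial (Fin 3) k), X 2} := by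
  have hhom : (pderiv 2 (quarticHom f)).IsHomogeneous (4 - 1) := (isHomogeneous_quarticHom f).pderiv
  have hren : pderiv 2 (quarticHom f) = rename xz (pderiv 1 (f.homogenize 4)) := by
    rw [quarticHom, ← xz_one, pderiv_rename xz_injective]
  have hs : ({(X 0 : MvPolynomial (Fin 3) k), X 2} : Set _) = X '' {0, 2} := by
    rw [Set.image_pair]
  rw [hs, mem_ideal_span_X_image]
  intro m hm
  have h1 : m 1 = 0 := apply_one_eq_zero_of_mem_support_rename (hren ▸ hm)
  have hdeg : m.degree = 4 - 1 := by
    by_contra h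
    exact (mem_support_iff.mp hm) (hhom.coeff_eq_zero h)
  have hm0 : m ≠ 0 := by
    rintro rfl
    simp at hdeg
  obtain ⟨j, hj⟩ := DFunLike.ne_iff.mp hm0
  fin_cases j
  · exact ⟨0, by simp, hj⟩
  · exact absurd h1 hj
  · exact ⟨2, by simp, hj⟩

/-- **Bezout, homogenised**: if `f` is separable of degree `≤ 4` then some power of `x₂` lies in the
ideal `(F₄, ∂₀F₄)`: homogenising `A f + B f' = 1` gives `x₂ᴺ = Â F₄ + B̂ ∂₀F₄`. [folklore] -/
theorem exists_X_two_pow_eq (f : Polynomial k) (hf : f.natDegree ≤ 4)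
    (hsep : IsCoprime f (Polynomial.derivative f)) :
    ∃ (A B : MvPolynomial (Fin 3) k) (N : ℕ),
      (X 2 : MvPolynomial (Fin 3) k) ^ N = A * quarticHom f + B * pderiv 0 (quarticHom f) := by
  obtain ⟨a, b, hab⟩ := hsep
  have hf' : (Polynomial.derivative f).natDegree ≤ 3 :=
    (Polynomial.natDegree_derivative_le f).trans (by omega)
  have key : (X 1 : MvPolynomial (Fin 2) k) ^ (a.natDegree + b.natDegree + 4) =
      a.homogenize (a.natDegree + b.natDegree) * f.homogenize 4 +
        b.homogenize (a.natDegree + b.natDegree + 1) * (Polynomial.derivative f).homogenize 3 := by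
    rw [← Polynomial.homogenize_mul _ _ (Nat.le_add_right _ _) hf,
      ← Polynomial.homogenize_mul _ _ (by omega) hf',
      show a.natDegree + b.natDegree + 1 + 3 = a.natDegree + b.natDegree + 4 by omega,
      ← Polynomial.homogenize_add, hab, Polynomial.homogenize_one]
  refine ⟨rename xz (a.homogenize (a.natDegree + b.natDegree)),
    rename xz (b.homogenize (a.natDegree + b.natDegree + 1)), a.natDegree + b.natDegree + 4, ?_⟩
  rw [pderiv_zero_quarticHom f hf, quarticHom, ← map_mul, ← map_mul, ← map_add, ← key, map_pow,
    rename_X, xz_one]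

/-! ### The projective Jacobian criterion for the Picard form -/

section Nonsingular

variable {K : Type*} [Field K]

/-- `∂₁ (x₁³ x₂ - F₄) = 3 x₁² x₂`. [folklore] -/
theorem pderiv_one_picardForm (f : Polynomial K) :
    pderiv 1 (picardForm f) = 3 * X 1 ^ 2 * X 2 := by
  rw [picardForm, map_sub, pderiv_one_quarticHom, sub_zero, Derivation.leibniz, Derivation.leibniz_pow,
    pderiv_X_self, pderiv_X_of_ne (by decide)]
  simp only [smul_eq_mul, mul_one, nsmul_eq_mul]
  ring

/-- `∂₂ (x₁³ x₂ - F₄) = x₁³ - ∂₂ F₄`. [folklore] -/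
theorem pderiv_two_picardForm (f : Polynomial K) :
    pderiv 2 (picardForm f) = X 1 ^ 3 - pderiv 2 (quarticHom f) := by
  rw [picardForm, map_sub, Derivation.leibniz, Derivation.leibniz_pow, pderiv_X_self,
    pderiv_X_of_ne (by decide)]
  simp

/-- `∂₀ (x₁³ x₂ - F₄) = - ∂₀ F₄`. [folklore] -/
theorem pderiv_zero_picardForm (f : Polynomial K) :
    pderiv 0 (picardForm f) = - pderiv 0 (quarticHom f) := by
  rw [picardForm, map_sub, Derivation.leibniz, Derivation.leibniz_pow, pderiv_X_of_ne (by decide),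
    pderiv_X_of_ne (by decide)]
  simp

/-- If a prime `𝔭 ∋ F, ∂ᵢF` contains `x₂` then it contains every variable (`deg f = 4`):
`F₄ ≡ a₄ x₀⁴ (mod x₂)` gives `x₀ ∈ 𝔭`, then `∂₂F = x₁³ - ∂₂F₄`, `∂₂F₄ ∈ (x₀, x₂)` gives `x₁ ∈ 𝔭`.
[folklore] -/
theorem X_mem_of_X_two_mem {f : Polynomial K} (hf4 : f.coeff 4 ≠ 0) {𝔭 : Ideal (MvPolynomial (Fin 3) K)}
    (hp : 𝔭.IsPrime) (hF : picardForm f ∈ 𝔭) (hd : ∀ j, pderiv j (picardForm f) ∈ 𝔭)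
    (h2 : (X 2 : MvPolynomial (Fin 3) K) ∈ 𝔭) (i : Fin 3) : (X i : MvPolynomial (Fin 3) K) ∈ 𝔭 := by
  have hH : quarticHom f ∈ 𝔭 := by
    have h := 𝔭.sub_mem (𝔭.mul_mem_left (X 1 ^ 3) h2) hF
    rwa [picardForm, sub_sub_cancel] at h
  have h0 : (X 0 : MvPolynomial (Fin 3) K) ∈ 𝔭 := by
    have hspan : Ideal.span {(X 2 : MvPolynomial (Fin 3) K)} ≤ 𝔭 :=
      (Ideal.span_singleton_le_iff_mem _).mpr h2
    have h := 𝔭.sub_mem hH (hspan (quarticHom_sub_mem_span f))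
    rw [sub_sub_cancel, Ideal.unit_mul_mem_iff_mem 𝔭 ((isUnit_iff_ne_zero.mpr hf4).map C)] at h
    exact hp.mem_of_pow_mem _ h
  have h1 : (X 1 : MvPolynomial (Fin 3) K) ∈ 𝔭 := by
    have hspan : Ideal.span {(X 0 : MvPolynomial (Fin 3) K), X 2} ≤ 𝔭 := by
      rw [Ideal.span_le]
      rintro x (rfl | rfl)
      exacts [h0, h2]
    have h := 𝔭.add_mem (hd 2) (hspan (pderiv_two_quarticHom_mem_span f))
    rw [pderiv_two_picardForm, sub_add_cancel] at h
    exact hp.mem_of_pow_mem _ h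
  fin_cases i
  exacts [h0, h1, h2]

/-- **The Picard form is nonsingular** (projective Jacobian criterion, Hartshorne I Ex. 5.8) when
`3 ≠ 0` in `K` and `f` is a separable quartic: from `∂₁F = 3x₁²x₂ ∈ 𝔭`, either `x₂ ∈ 𝔭`
(`X_mem_of_X_two_mem`), or `x₁ ∈ 𝔭`, whence `F₄, ∂₀F₄ ∈ 𝔭` and the homogenised Bezout identity
`x₂ᴺ = Â F₄ + B̂ ∂₀F₄` puts `x₂` in `𝔭` as well. Geometrically: an affine singular point would need
`3y² = 0 = f(x) = f'(x)`, and the point at infinity `(0 : 1 : 0)` is smooth (`∂F/∂z = y³ ≠ 0` there).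
[cite: Hartshorne1977, I Ex. 5.8] -/
theorem forall_X_mem_of_prime {f : Polynomial K} (h3 : (3 : K) ≠ 0) (hf : f.natDegree ≤ 4)
    (hf4 : f.coeff 4 ≠ 0) (hsep : IsCoprime f (Polynomial.derivative f))
    (𝔭 : Ideal (MvPolynomial (Fin 3) K)) (hp : 𝔭.IsPrime) (hF : picardForm f ∈ 𝔭)
    (hd : ∀ j, pderiv j (picardForm f) ∈ 𝔭) (i : Fin 3) : (X i : MvPolynomial (Fin 3) K) ∈ 𝔭 := by
  refine X_mem_of_X_two_mem hf4 hp hF hd ?_ i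
  -- `∂₁F = 3 x₁² x₂ ∈ 𝔭`
  have h12 : (X 1 : MvPolynomial (Fin 3) K) ^ 2 * X 2 ∈ 𝔭 := by
    have h := hd 1
    rw [pderiv_one_picardForm, mul_assoc, ← map_ofNat (C : K →+* MvPolynomial (Fin 3) K) 3,
      Ideal.unit_mul_mem_iff_mem 𝔭 ((IsUnit.mk0 _ h3).map C)] at h
    exact h
  rcases hp.mem_or_mem h12 with h1 | h2
  · -- `x₁ ∈ 𝔭`: then `F₄, ∂₀F₄ ∈ 𝔭`, and Bezout gives `x₂ ∈ 𝔭`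
    have h1' : (X 1 : MvPolynomial (Fin 3) K) ∈ 𝔭 := hp.mem_of_pow_mem _ h1
    have hH : quarticHom f ∈ 𝔭 := by
      have h := 𝔭.sub_mem (𝔭.mul_mem_right (X 2) (𝔭.pow_mem_of_mem h1' 3 (by omega))) hF
      rwa [picardForm, sub_sub_cancel] at h
    have hH' : pderiv 0 (quarticHom f) ∈ 𝔭 := by
      have h := 𝔭.neg_mem (hd 0)
      rwa [pderiv_zero_picardForm, neg_neg] at h
    obtain ⟨A, B, N, hN⟩ := exists_X_two_pow_eq f hf hsep
    refine hp.mem_of_pow_mem N ?_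
    rw [hN]
    exact 𝔭.add_mem (𝔭.mul_mem_left _ hH) (𝔭.mul_mem_left _ hH')
  · exact h2

end Nonsingular

end Literature.AlgebraicGeometry.Motives.PicardQuartic

end
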